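import Summits.ResolutionOfSingularities.ResolutionOfSingularities.Theorems.FrobeniusClosingSteerRadicandCohenFrame
import Summits.ResolutionOfSingularities.ResolutionOfSingularities.Theorems.FrobeniusClosingSteerJacobianFiniteColength
import Summits.ResolutionOfSingularities.ResolutionOfSingularities.Theorems.FrobeniusClosingCampaignW41PowerSeriesDerivations
import Mathlib.RingTheory.Length
import HarnessLib

/-!
# Steer hG3 kernel programme, item K1: ISOLATED `p`-RADICAND GERM ⇒ FINITE JACOBIAN COLENGTH IN THE COHEN MODEL OF THE COMPLETION

OURS (campaign res-hironaka, rung L ★L-G4, slot W4.1, crux `Steer` stmt-ResolutionOfSingularities-16345; res-L0-w41-plan-1 RULINGS 136a/137b,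
kernel item K1 of res-L0-w41-tri-2's audit `gpd/audit_GPERF_DIRECT.md` 74a3c125d37100b5 §6; res-L0-w41-stub-3 g6; replaces the role of no printed
item; NOT a statement of the manuscript under review [claim: Hironaka2017, status: under-review]; AI review is weaker than expert review).
Theses-free, definition-free. Consumer: res-L0-w41-stub-2's F♭ assembly of `NoEternalConstOrderIsolatedChainPerfect 2 c (2e)` (fuel `τ = colength
of the Jacobian ideal of f̂` must be FINITE at stage 0; `τ ≥ M − 1` after `M` free steps is stub-2's Lemma F♭).

For a regular local EXCELLENT ring `S` of characteristic `p` and a radicand `f ∈ S` whose torsor germ `S[T]/(T^p − f)` has an ISOLATED singularity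
(`HasIsolatedSingularity (RadicandRing S p f)` of the words, unfolded), and for ANY Cohen isomorphism `φ : Ŝ ≃+* K⟦X₁, …, X_d⟧` with `K` perfect:
* `finite_quotient_span_pderiv_of_isolated` — `K⟦X⟧ ⧸ (∂(φ f̂)/∂X_i)_i` is finite over `K` (pv-004's ascent p513029 `RadicandAscent.isolated_adicCompletion_of_isExcellentRing`,
  transport `RadicandCohenFrame.isolated_of_ringEquiv`, and the Jacobian criterion `JacobianCriterionFormal.isolated_iff_finite_quotient_jacobian` (p511731 family)
  at `p`-rank `e = 0`: `pAdjoin p ∅ = ⊤` for a perfect field);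
* `finite_quotient_span_derivation_of_isolated` — the same for the ABSOLUTE Jacobian ideal `(D (φ f̂))_{D ∈ Der_ℤ}` (= res-L0-w41-stub-2's `jacobianIdealAbs`
  unfolded; tree `span_derivation_int_apply_eq_span_pderiv`, `K` perfect);
* `length_quotient_span_derivation_lt_top_of_isolated` — hence `ℓ_{K⟦X⟧}(K⟦X⟧ ⧸ 𝒥_abs(φ f̂)) < ⊤` (`τ < ∞`; finite over `K` ⇒ Artinian and Noetherian over
  `K⟦X⟧` by `isArtinian_of_tower` / `isNoetherian_of_tower` ⇒ `Module.length_ne_top`).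
A Cohen isomorphism exists (`exists_ringEquiv_mvPowerSeries_residueField`, Matsumura 29.7; `K = κ(Ŝ) ≅ κ(S)` is perfect when `κ(S)` is):
`exists_cohenIso_perfect`. [cite: Matsumura1987, Thm. 29.7; Thm. 30.10; §32 p. 260] [folklore]
-/

noncomputable section

-- single-problem summit: the doubled namespace component `ResolutionOfSingularities` is forced
set_option linter.dupNamespace false

namespace Summit.ResolutionOfSingularities.ResolutionOfSingularities.Theorems.SwitchingDichotomy.IsolatedColength

open IsLocalRing Polynomial
open Literature.AlgebraicGeometry.Resolution Literature.FieldTheory.Separability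
open Summit.ResolutionOfSingularities.ResolutionOfSingularities.Theorems.SwitchingDichotomy

universe u

/-- Over a PERFECT field of characteristic `p` the `p`-adjunction of the empty family is everything: `κ = κ^p`. [folklore] -/
theorem pAdjoin_range_elim0_eq_top (p : ℕ) [Fact p.Prime] (K : Type u) [Field K] [CharP K p] [PerfectField K] :
    pAdjoin p (Set.range (Fin.elim0 : Fin 0 → K)) = ⊤ := by
  haveI : ExpChar K p := ExpChar.prime Fact.out
  rw [Set.range_eq_empty, pAdjoin, Set.union_empty, Set.range_eq_univ.mpr (surjective_frobenius K p)]
  exact top_le_iff.mp fun x _ => Subfield.subset_closure (Set.mem_univ x)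

/-- **A Cohen isomorphism with PERFECT coefficient field exists** for a regular local ring of characteristic `p` with perfect residue field:
`Ŝ ≃+* κ(Ŝ)⟦X₁, …, X_d⟧`, `d = μ(𝔪Ŝ)`, and `κ(Ŝ) ≅ κ(S)` is perfect. [cite: Matsumura1987, Thm. 29.7] -/
theorem exists_cohenIso_perfect (p : ℕ) [Fact p.Prime] (S : Type u) [CommRing S] [IsRegularLocalRing S] [CharP S p]
    [PerfectField (ResidueField S)] :
    PerfectField (ResidueField (AdicCompletion (maximalIdeal S) S)) ∧
      Nonempty (AdicCompletion (maximalIdeal S) S ≃+*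
        MvPowerSeries (Fin (maximalIdeal (AdicCompletion (maximalIdeal S) S)).spanFinrank)
          (ResidueField (AdicCompletion (maximalIdeal S) S))) := by
  haveI : IsNoetherianRing (AdicCompletion (maximalIdeal S) S) := isNoetherianRing_adicCompletion_maximalIdeal S
  haveI : IsRegularLocalRing (AdicCompletion (maximalIdeal S) S) := isRegularLocalRing_adicCompletion S
  haveI : CharP (AdicCompletion (maximalIdeal S) S) p := RadicandCohenFrame.charP_adicCompletion p S
  refine ⟨?_, exists_ringEquiv_mvPowerSeries_residueField (AdicCompletion (maximalIdeal S) S)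
    (ZMod.castHom (dvd_refl p) (AdicCompletion (maximalIdeal S) S)).range (RadicandCohenFrame.isField_range_castHom p)⟩
  let ρ : ResidueField S ≃+* ResidueField (AdicCompletion (maximalIdeal S) S) :=
    RingEquiv.ofBijective _ (AdicCompletion.residueField_map_bijective S)
  exact PerfectField.of_ringEquiv ρ

variable (p : ℕ) [Fact p.Prime] {S : Type u} [CommRing S] [IsRegularLocalRing S] [CharP S p]

/-- **K1 (a) · isolated ⇒ finite colength of `(∂_i)` in the Cohen model.** For a regular local excellent ring `S` of characteristic `p`, a radicand
`f` with ISOLATED torsor germ, and any ring isomorphism `φ : Ŝ ≃+* K⟦X₁, …, X_d⟧` onto a power series ring over a PERFECT field `K`: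
`K⟦X⟧ ⧸ (∂(φ f̂)/∂X_i)` is a finite `K`-module. [cite: Matsumura1987, Thm. 30.10; §32 p. 260] -/
theorem finite_quotient_span_pderiv_of_isolated (hS : IsExcellentRing S) (f : S)
    (hisol : ∀ (P : Ideal (AdjoinRoot ((X : S[X]) ^ p - C f))) [P.IsPrime],
      (∃ Q : Ideal (AdjoinRoot ((X : S[X]) ^ p - C f)), Q.IsPrime ∧ P < Q) → IsRegularLocalRing (Localization.AtPrime P))
    {d : ℕ} {K : Type u} [Field K] [CharP K p] [PerfectField K]
    (φ : AdicCompletion (maximalIdeal S) S ≃+* MvPowerSeries (Fin d) K) :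
    Module.Finite K (MvPowerSeries (Fin d) K ⧸
      Ideal.span (Set.range fun i => MvPowerSeries.pderiv i (φ (algebraMap S (AdicCompletion (maximalIdeal S) S) f)))) := by
  haveI : IsNoetherianRing (AdicCompletion (maximalIdeal S) S) := isNoetherianRing_adicCompletion_maximalIdeal S
  -- isolatedness: `S ⇒ Ŝ ⇒ K⟦X⟧`
  have h1 := RadicandAscent.isolated_adicCompletion_of_isExcellentRing p f hS hisol
  have h2 := RadicandCohenFrame.isolated_of_ringEquiv p φ (algebraMap S (AdicCompletion (maximalIdeal S) S) f) h1
  -- the Jacobian criterion at `p`-rank `0`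
  have h3 := (JacobianCriterionFormal.isolated_iff_finite_quotient_jacobian p (Fin.elim0 : Fin 0 → K)
    (Fin.elim0 : Fin 0 → Derivation ℤ K K) (fun l => l.elim0) (pAdjoin_range_elim0_eq_top p K) _).mp h2
  have he : Set.range (fun l : Fin 0 => (Fin.elim0 l : Derivation ℤ K K).mvPowerSeriesCoeffwise
      (φ (algebraMap S (AdicCompletion (maximalIdeal S) S) f))) = ∅ := Set.range_eq_empty _
  rw [he, Set.union_empty] at h3
  exact h3

/-- **K1 (b) · the same for the ABSOLUTE Jacobian ideal** `(D g)_{D ∈ Der_ℤ(K⟦X⟧)}` (res-L0-w41-stub-2's `jacobianIdealAbs`, unfolded): over a perfect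
field every `ℤ`-derivation of `K⟦X⟧` is `Σ D(X_i) ∂_i`, so the two ideals coincide. [cite: Matsumura1987, Thm. 30.10] -/
theorem finite_quotient_span_derivation_of_isolated (hS : IsExcellentRing S) (f : S)
    (hisol : ∀ (P : Ideal (AdjoinRoot ((X : S[X]) ^ p - C f))) [P.IsPrime],
      (∃ Q : Ideal (AdjoinRoot ((X : S[X]) ^ p - C f)), Q.IsPrime ∧ P < Q) → IsRegularLocalRing (Localization.AtPrime P))
    {d : ℕ} {K : Type u} [Field K] [CharP K p] [PerfectField K]
    (φ : AdicCompletion (maximalIdeal S) S ≃+* MvPowerSeries (Fin d) K) :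
    Module.Finite K (MvPowerSeries (Fin d) K ⧸
      Ideal.span (Set.range fun D : Derivation ℤ (MvPowerSeries (Fin d) K) (MvPowerSeries (Fin d) K) =>
        D (φ (algebraMap S (AdicCompletion (maximalIdeal S) S) f)))) := by
  rw [span_derivation_int_apply_eq_span_pderiv p]
  exact finite_quotient_span_pderiv_of_isolated p hS f hisol φ

/-- **K1 (c) · `τ < ∞`**: the Jacobian colength `ℓ(K⟦X⟧ ⧸ 𝒥_abs(φ f̂))` is finite (a `K⟦X⟧`-module finite over the coefficient field `K` is Artinian and
Noetherian). [cite: Matsumura1987, Thm. 30.10] -/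
theorem length_quotient_span_derivation_lt_top_of_isolated (hS : IsExcellentRing S) (f : S)
    (hisol : ∀ (P : Ideal (AdjoinRoot ((X : S[X]) ^ p - C f))) [P.IsPrime],
      (∃ Q : Ideal (AdjoinRoot ((X : S[X]) ^ p - C f)), Q.IsPrime ∧ P < Q) → IsRegularLocalRing (Localization.AtPrime P))
    {d : ℕ} {K : Type u} [Field K] [CharP K p] [PerfectField K]
    (φ : AdicCompletion (maximalIdeal S) S ≃+* MvPowerSeries (Fin d) K) :
    Module.length (MvPowerSeries (Fin d) K) (MvPowerSeries (Fin d) K ⧸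
      Ideal.span (Set.range fun D : Derivation ℤ (MvPowerSeries (Fin d) K) (MvPowerSeries (Fin d) K) =>
        D (φ (algebraMap S (AdicCompletion (maximalIdeal S) S) f)))) < ⊤ := by
  set J : Ideal (MvPowerSeries (Fin d) K) := Ideal.span (Set.range fun D : Derivation ℤ (MvPowerSeries (Fin d) K)
    (MvPowerSeries (Fin d) K) => D (φ (algebraMap S (AdicCompletion (maximalIdeal S) S) f))) with hJ
  haveI hfin : Module.Finite K (MvPowerSeries (Fin d) K ⧸ J) := finite_quotient_span_derivation_of_isolated p hS f hisol φ
  haveI : IsArtinian (MvPowerSeries (Fin d) K) (MvPowerSeries (Fin d) K ⧸ J) := isArtinian_of_tower K inferInstance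
  haveI : IsNoetherian (MvPowerSeries (Fin d) K) (MvPowerSeries (Fin d) K ⧸ J) := isNoetherian_of_tower K inferInstance
  exact lt_top_iff_ne_top.mpr Module.length_ne_top

/-! ## Appendix (res-L0-w41-plan-1 RULING 144 candidate book: imperfect residue fields of finite `p`-rank) -/

/-- **K1 (a′) · the general `p`-rank form.** For a regular local excellent ring `S` of characteristic `p`, a radicand `f` with ISOLATED torsor germ, any
ring isomorphism `φ : Ŝ ≃+* K⟦X₁, …, X_d⟧`, and any `p`-basis-dual frame `(γ, D)` of `K` (`D_l γ_{l'} = δ`, `K = K^p(γ)`; `e = 0` when `K` is perfect):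
`K⟦X⟧ ⧸ (∂(φ f̂)/∂X_i, D̃_l (φ f̂))` is a finite `K`-module — the Jacobian colength with the coefficient derivations is finite. (Same chain as (a),
the Jacobian criterion `isolated_iff_finite_quotient_jacobian` at `p`-rank `e`.) [cite: Matsumura1987, Thm. 30.10; §32 p. 260] -/
theorem finite_quotient_span_jacobian_of_isolated (hS : IsExcellentRing S) (f : S)
    (hisol : ∀ (P : Ideal (AdjoinRoot ((X : S[X]) ^ p - C f))) [P.IsPrime],
      (∃ Q : Ideal (AdjoinRoot ((X : S[X]) ^ p - C f)), Q.IsPrime ∧ P < Q) → IsRegularLocalRing (Localization.AtPrime P))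
    {d : ℕ} {K : Type u} [Field K] [CharP K p] (φ : AdicCompletion (maximalIdeal S) S ≃+* MvPowerSeries (Fin d) K)
    {e : ℕ} (γ : Fin e → K) (D : Fin e → Derivation ℤ K K) (hdual : ∀ l l', D l (γ l') = if l' = l then 1 else 0)
    (hgen : pAdjoin p (Set.range γ) = ⊤) :
    Module.Finite K (MvPowerSeries (Fin d) K ⧸
      Ideal.span (Set.range (fun i => MvPowerSeries.pderiv i (φ (algebraMap S (AdicCompletion (maximalIdeal S) S) f))) ∪
        Set.range (fun l => (D l).mvPowerSeriesCoeffwise (φ (algebraMap S (AdicCompletion (maximalIdeal S) S) f))))) := by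
  haveI : IsNoetherianRing (AdicCompletion (maximalIdeal S) S) := isNoetherianRing_adicCompletion_maximalIdeal S
  have h1 := RadicandAscent.isolated_adicCompletion_of_isExcellentRing p f hS hisol
  have h2 := RadicandCohenFrame.isolated_of_ringEquiv p φ (algebraMap S (AdicCompletion (maximalIdeal S) S) f) h1
  exact (JacobianCriterionFormal.isolated_iff_finite_quotient_jacobian p γ D hdual hgen _).mp h2

/-- **K1 (c′) · finite LENGTH of the `p`-rank-`e` Jacobian quotient** (`τ⁺ < ∞`). [cite: Matsumura1987, Thm. 30.10] -/
theorem length_quotient_span_jacobian_lt_top_of_isolated (hS : IsExcellentRing S) (f : S)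
    (hisol : ∀ (P : Ideal (AdjoinRoot ((X : S[X]) ^ p - C f))) [P.IsPrime],
      (∃ Q : Ideal (AdjoinRoot ((X : S[X]) ^ p - C f)), Q.IsPrime ∧ P < Q) → IsRegularLocalRing (Localization.AtPrime P))
    {d : ℕ} {K : Type u} [Field K] [CharP K p] (φ : AdicCompletion (maximalIdeal S) S ≃+* MvPowerSeries (Fin d) K)
    {e : ℕ} (γ : Fin e → K) (D : Fin e → Derivation ℤ K K) (hdual : ∀ l l', D l (γ l') = if l' = l then 1 else 0)
    (hgen : pAdjoin p (Set.range γ) = ⊤) :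
    Module.length (MvPowerSeries (Fin d) K) (MvPowerSeries (Fin d) K ⧸
      Ideal.span (Set.range (fun i => MvPowerSeries.pderiv i (φ (algebraMap S (AdicCompletion (maximalIdeal S) S) f))) ∪
        Set.range (fun l => (D l).mvPowerSeriesCoeffwise (φ (algebraMap S (AdicCompletion (maximalIdeal S) S) f))))) < ⊤ := by
  set J : Ideal (MvPowerSeries (Fin d) K) :=
    Ideal.span (Set.range (fun i => MvPowerSeries.pderiv i (φ (algebraMap S (AdicCompletion (maximalIdeal S) S) f))) ∪
      Set.range (fun l => (D l).mvPowerSeriesCoeffwise (φ (algebraMap S (AdicCompletion (maximalIdeal S) S) f)))) with hJ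
  haveI hfin : Module.Finite K (MvPowerSeries (Fin d) K ⧸ J) :=
    finite_quotient_span_jacobian_of_isolated p hS f hisol φ γ D hdual hgen
  haveI : IsArtinian (MvPowerSeries (Fin d) K) (MvPowerSeries (Fin d) K ⧸ J) := isArtinian_of_tower K inferInstance
  haveI : IsNoetherian (MvPowerSeries (Fin d) K) (MvPowerSeries (Fin d) K ⧸ J) := isNoetherian_of_tower K inferInstance
  exact lt_top_iff_ne_top.mpr Module.length_ne_top

end Summit.ResolutionOfSingularities.ResolutionOfSingularities.Theorems.SwitchingDichotomy.IsolatedColength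

end
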